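import Summits.AtomisticToContinuum.FouriersLaw.Theorems.CornerNoDip.Negative.ColdHaloTriangle

/-!
# Cold-halo witness for `CornerNoDip` — part 2: the profile `prof n`

Helper lemmas for `Negative/ColdHalo.lean` (crux stmt-AtomisticToContinuum-16009).  The COLD-HALO
PROFILE `prof n = (5/8)·tri n + (1/4)·tri n(· ∓ 2n) − (1/16)·tri n(· ∓ 4n)` (positive core,
positive shoulders at `±2n`, negative lobes at `±4n`), pinned by the hypothesis `hprof`:
conservation (mass `1`), spread (second moment `(n² - 1)/6`, the halo has zero second moment),
the FACTORISED transform `Fejér_n(k)·(5/8 + cos(2nk)/2 − cos(4nk)/8) = Fejér_n(k)(1 − sin⁴(nk))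
∈ [0, 1]` (Bochner and `f̂ ≤ χ`), return value `5/(8n)`, evenness, support `|x| < 5n`,
weighted summability and Parseval at `0`.
-/

noncomputable section

namespace Summit.AtomisticToContinuum.FouriersLaw.Theorems.CornerNoDip.Negative.ColdHalo

open Finset Real MeasureTheory Set Filter Topology

section Witness

variable {tri : ℕ → ℤ → ℝ}
  (htri : ∀ (n : ℕ) (x : ℤ), tri n x =
    (((Finset.range n ×ˢ Finset.range n).filter
      (fun ab : ℕ × ℕ => x = (ab.1 : ℤ) - (ab.2 : ℤ))).card : ℝ) / (n : ℝ) ^ 2)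

include htri

variable {prof : ℕ → ℤ → ℝ}
  (hprof : ∀ (n : ℕ) (x : ℤ), prof n x = 5 / 8 * tri n x
    + 1 / 4 * (tri n (x - 2 * (n : ℤ)) + tri n (x + 2 * (n : ℤ)))
    - 1 / 16 * (tri n (x - 4 * (n : ℤ)) + tri n (x + 4 * (n : ℤ))))

include hprof

/-- Pairing a test sequence with the cold-halo profile, term by term. [folklore] -/
theorem tsum_mul_prof (n : ℕ) (φ : ℤ → ℝ) :
    ∑' x : ℤ, φ x * prof n x = 5 / 8 * (∑' x : ℤ, φ x * tri n x)
      + 1 / 4 * ((∑' x : ℤ, φ x * tri n (x - 2 * (n : ℤ))) + ∑' x : ℤ, φ x * tri n (x + 2 * (n : ℤ)))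
      - 1 / 16 * ((∑' x : ℤ, φ x * tri n (x - 4 * (n : ℤ))) + ∑' x : ℤ, φ x * tri n (x + 4 * (n : ℤ))) := by
  have e : ∀ x : ℤ, φ x * prof n x = 5 / 8 * (φ x * tri n x)
      + 1 / 4 * (φ x * tri n (x - 2 * (n : ℤ)) + φ x * tri n (x + 2 * (n : ℤ)))
      - 1 / 16 * (φ x * tri n (x - 4 * (n : ℤ)) + φ x * tri n (x + 4 * (n : ℤ))) := by
    intro x; rw [hprof]; ring
  simp_rw [e]
  have s0 := summable_mul_tri htri n φ
  have s1 := summable_mul_tri_shift htri n φ (2 * (n : ℤ))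
  have s2 := summable_mul_tri_shift' htri n φ (2 * (n : ℤ))
  have s3 := summable_mul_tri_shift htri n φ (4 * (n : ℤ))
  have s4 := summable_mul_tri_shift' htri n φ (4 * (n : ℤ))
  rw [((s0.mul_left _).add ((s1.add s2).mul_left _)).tsum_sub ((s3.add s4).mul_left _),
    (s0.mul_left _).tsum_add ((s1.add s2).mul_left _), tsum_mul_left, tsum_mul_left, tsum_mul_left,
    s1.tsum_add s2, s3.tsum_add s4]

/-- CONSERVATION: the cold-halo profile has mass `1` (`5/8 + 2/4 - 2/16 = 1`). [folklore] -/
theorem tsum_prof (n : ℕ) (hn : 1 ≤ n) : ∑' x : ℤ, prof n x = 1 := by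
  have h := tsum_mul_prof htri hprof n (fun _ => 1)
  simp only [one_mul] at h
  rw [h, tsum_tri_shift htri n hn, tsum_tri_shift' htri n hn, tsum_tri_shift htri n hn,
    tsum_tri_shift' htri n hn]
  have h0 := tsum_tri_shift htri n hn 0
  simp only [sub_zero] at h0
  rw [h0]; norm_num

/-- SPREAD: the cold-halo profile has second moment `(n² - 1)/6` — the halo (`+1/4` at `±2n`, `-1/16` at `±4n`) has zero second moment. [folklore] -/
theorem tsum_sq_mul_prof (n : ℕ) (hn : 1 ≤ n) :
    ∑' x : ℤ, (x : ℝ) ^ 2 * prof n x = ((n : ℝ) ^ 2 - 1) / 6 := by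
  rw [tsum_mul_prof htri hprof n (fun x : ℤ => (x : ℝ) ^ 2), tsum_sq_mul_tri_shift htri n hn,
    tsum_sq_mul_tri_shift' htri n hn, tsum_sq_mul_tri_shift htri n hn, tsum_sq_mul_tri_shift' htri n hn]
  have h0 := tsum_sq_mul_tri_shift htri n hn 0
  simp only [sub_zero, Int.cast_zero] at h0
  rw [h0]; push_cast; ring

/-- FACTORISATION of the transform: `f̂ = Fejér_n(k)·(5/8 + cos(2nk)/2 - cos(4nk)/8)` (`= Fejér_n(k)·(1 - sin⁴(nk))`). [folklore] -/
theorem tsum_cos_mul_prof (n : ℕ) (k : ℝ) :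
    ∑' x : ℤ, Real.cos (k * x) * prof n x =
      ((∑ a ∈ range n, Real.cos (k * a)) ^ 2 + (∑ a ∈ range n, Real.sin (k * a)) ^ 2) / (n : ℝ) ^ 2 *
        (5 / 8 + Real.cos (k * (2 * n)) / 2 - Real.cos (k * (4 * n)) / 8) := by
  rw [tsum_mul_prof htri hprof n (fun x : ℤ => Real.cos (k * x)), tsum_cos_mul_tri_shift htri,
    tsum_cos_mul_tri_shift' htri, tsum_cos_mul_tri_shift htri, tsum_cos_mul_tri_shift' htri]
  have h0 := tsum_cos_mul_tri_shift htri n k 0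
  simp only [sub_zero, Int.cast_zero, mul_zero, Real.cos_zero, one_mul] at h0
  rw [h0]; push_cast; ring

/-- BOCHNER: the transform of the cold-halo profile is `≥ 0`. [folklore] -/
theorem tsum_cos_mul_prof_nonneg (n : ℕ) (k : ℝ) :
    0 ≤ ∑' x : ℤ, Real.cos (k * x) * prof n x := by
  rw [tsum_cos_mul_prof htri hprof]
  refine mul_nonneg (by positivity) ?_
  rw [show k * (4 * n) = 2 * (k * (2 * n)) by ring, Real.cos_two_mul]
  nlinarith [Real.neg_one_le_cos (k * (2 * n)), Real.cos_le_one (k * (2 * n))]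

/-- `f̂ ≤ 1 = χ(k)`: the fibred conductivity of the witness is `≥ 0`. [folklore] -/
theorem tsum_cos_mul_prof_le_one (n : ℕ) (hn : 1 ≤ n) (k : ℝ) :
    ∑' x : ℤ, Real.cos (k * x) * prof n x ≤ 1 := by
  rw [tsum_cos_mul_prof htri hprof]
  have hn' : (0 : ℝ) < n := by exact_mod_cast hn
  have h1 : ((∑ a ∈ range n, Real.cos (k * a)) ^ 2 + (∑ a ∈ range n, Real.sin (k * a)) ^ 2) /
      (n : ℝ) ^ 2 ≤ 1 := by
    rw [div_le_one (by positivity)]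
    exact sum_pair_sq_le n k
  have h2 : 0 ≤ ((∑ a ∈ range n, Real.cos (k * a)) ^ 2 + (∑ a ∈ range n, Real.sin (k * a)) ^ 2) /
      (n : ℝ) ^ 2 := by positivity
  have h3 : 5 / 8 + Real.cos (k * (2 * n)) / 2 - Real.cos (k * (4 * n)) / 8 ≤ 1 := by
    rw [show k * (4 * n) = 2 * (k * (2 * n)) by ring, Real.cos_two_mul]
    nlinarith [Real.neg_one_le_cos (k * (2 * n)), Real.cos_le_one (k * (2 * n))]
  have h4 : 0 ≤ 5 / 8 + Real.cos (k * (2 * n)) / 2 - Real.cos (k * (4 * n)) / 8 := by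
    rw [show k * (4 * n) = 2 * (k * (2 * n)) by ring, Real.cos_two_mul]
    nlinarith [Real.neg_one_le_cos (k * (2 * n)), Real.cos_le_one (k * (2 * n))]
  nlinarith

/-- RETURN VALUE: `prof n 0 = 5/(8n)` (K1 with `n = ⌈1/√ν⌉₊`). [folklore] -/
theorem prof_zero (n : ℕ) (hn : 1 ≤ n) : prof n 0 = 5 / (8 * n) := by
  rw [hprof, tri_zero htri n hn, tri_eq_zero_of htri n _ (by omega), tri_eq_zero_of htri n _ (by omega),
    tri_eq_zero_of htri n _ (by omega), tri_eq_zero_of htri n _ (by omega)]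
  ring

/-- The cold-halo profile is even. [folklore] -/
theorem prof_neg (n : ℕ) (x : ℤ) : prof n (-x) = prof n x := by
  rw [hprof, hprof, tri_neg htri, show -x - 2 * (n:ℤ) = -(x + 2 * n) by ring, tri_neg htri,
    show -x + 2 * (n:ℤ) = -(x - 2 * n) by ring, tri_neg htri,
    show -x - 4 * (n:ℤ) = -(x + 4 * n) by ring, tri_neg htri,
    show -x + 4 * (n:ℤ) = -(x - 4 * n) by ring, tri_neg htri]
  ring

/-- The cold-halo profile is supported in `|x| < 5n`. [folklore] -/
theorem prof_eq_zero_of (n : ℕ) (x : ℤ) (h : 5 * (n : ℤ) ≤ x ∨ x ≤ -(5 * (n : ℤ))) : prof n x = 0 := by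
  rw [hprof, tri_eq_zero_of htri n _ (by omega), tri_eq_zero_of htri n _ (by omega),
    tri_eq_zero_of htri n _ (by omega), tri_eq_zero_of htri n _ (by omega),
    tri_eq_zero_of htri n _ (by omega)]
  ring

/-- `(1 + x²)|prof n x|` is summable (finite support). [folklore] -/
theorem summable_weight_prof (n : ℕ) :
    Summable (fun x : ℤ => (1 + (x : ℝ) ^ 2) * |prof n x|) := by
  refine summable_of_ne_finset_zero (s := Finset.Ioo (-(5 * (n : ℤ))) (5 * n)) (fun x hx => ?_)
  rw [prof_eq_zero_of htri hprof n x ?_, abs_zero, mul_zero]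
  rw [Finset.mem_Ioo] at hx
  omega

/-- PARSEVAL at `0` for the cold-halo profile: `∫_{-π}^{π} f̂ = 2π·prof n 0`. [folklore] -/
theorem parseval_prof (n : ℕ) (hn : 1 ≤ n) :
    ∫ k in (-Real.pi)..Real.pi, (∑' x : ℤ, Real.cos (k * x) * prof n x) = 2 * Real.pi * prof n 0 := by
  set S : Finset ℤ := Finset.Ioo (-(5 * (n : ℤ))) (5 * n) with hS
  have hsupp : ∀ x ∉ S, prof n x = 0 := fun x hx => by
    apply prof_eq_zero_of htri hprof
    rw [hS, Finset.mem_Ioo] at hx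
    omega
  have hfun : ∀ k : ℝ, (∑' x : ℤ, Real.cos (k * x) * prof n x) =
      ∑ x ∈ S, Real.cos (k * x) * prof n x := by
    intro k
    refine tsum_eq_sum ?_
    intro x hx
    rw [hsupp x hx, mul_zero]
  simp_rw [hfun]
  have hint : ∀ x ∈ S, IntervalIntegrable (fun k : ℝ => Real.cos (k * x) * prof n x)
      MeasureTheory.volume (-Real.pi) Real.pi := by
    intro x _
    apply Continuous.intervalIntegrable
    fun_prop
  rw [intervalIntegral.integral_finsetSum hint]
  simp_rw [intervalIntegral.integral_mul_const, integral_cos_mul_int, ite_mul, zero_mul]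
  rw [Finset.sum_ite_eq']
  have h0 : (0 : ℤ) ∈ S := by rw [hS, Finset.mem_Ioo]; omega
  rw [if_pos h0]

end Witness

end Summit.AtomisticToContinuum.FouriersLaw.Theorems.CornerNoDip.Negative.ColdHalo

end
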